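import Mathlib.NumberTheory.NumberField.InfinitePlace.Embeddings
import Mathlib.NumberTheory.Padics.PadicVal.Basic
import Mathlib.RingTheory.DedekindDomain.AdicValuation
import Mathlib.RingTheory.Ideal.Norm.AbsNorm
import Literature.NumberTheory.EllipticCurves.PAdicHeightsK
import Literature.NumberTheory.EllipticCurves.PadicSigma
import HarnessLib

/-!
# The canonical cyclotomic `p`-adic height: the predicates `PAdicHeightData.IsCanonical` and
`PAdicHeightDataK.IsCanonical`

Trunk T-NT-EC (Literature/NumberTheory/EllipticCurves); definition requests
`defn-IsCanonicalPAdicHeight` (`ℚ`) and `defn-IsCanonicalPAdicHeightK` (number field `K`), route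
BirchSwinnertonDyer/PAdicOrder (consumers: stmt-0138 Schneider, wi-03669, wi-03670 / stmt-0515
`p`-adic Gross–Zagier, `PAdicBSDConjecture W p D`).

The hypothesis structures `PAdicHeightData W p` (`PAdicHeights.lean`) and `PAdicHeightDataK W p K`
(`PAdicHeightsK.lean`) axiomatise only a symmetric bilinear torsion-vanishing pairing. This file
PINS the canonical one by the Mazur–Tate / Mazur–Stein–Tate sigma-function formula, in the
normalisation of Stein–Wuthrich 2013, §4.1, eq. (4.1) (the one for which the tree's
`PAdicBSDConjecture`, transcribed from SW 2013 Conj. 5.1, is MTT's conjecture):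

* over `ℚ` (SW 2013 (4.1); MST 2006 §1 up to the factor `-2p`, cf. SW footnote 4 and Harvey 2008
  §1): for a non-torsion `P = (x, y) ∈ E(ℚ)` which reduces into `E₁` at `p` (and into the range of
  convergence `ord_p z(P) > 1/(p-1)` of Bernardi's `σ`) and to a NON-SINGULAR point modulo every
  prime (globally minimal `W`), writing `x = a/e²`,
  `ĥ_p(P) = 2 log_p (e(P) / σ_p(z(P))) = log_p(den x) - 2 log_p σ_p(z(P))`,
  `z(P) = -x/y`, `σ_p` the canonical `p`-adic sigma function (`PadicSigma.lean`), `log_p` the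
  Iwasawa logarithm (`Literature.NumberTheory.EllipticCurves.padicLog`); and `⟨P, P⟩_p = ĥ_p(P)`
  (`⟨P, Q⟩ = ½(ĥ(P+Q) - ĥ(P) - ĥ(Q))`).
* over a number field `K` in which `p` is TOTALLY SPLIT (Balakrishnan–Çiperiani–Stein 2015, §4.1
  eq. (4.1), from MST 2006; same `-2p` renormalisation; sum over the places of `K`, so that the
  restriction to `E(ℚ)` is `[K:ℚ] · ĥ_p`, the tree's `RestrictsTo` convention): for non-torsion
  `P = (x, y) ∈ E(K)` reducing into `E₁` above `p` and non-singularly everywhere (globally minimal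
  `W ⊗ K`),
  `ĥ_{p,K}(P) = log_p N(𝔡(x)) - 2 Σ_{ι : K → ℚ_p} log_p σ_p(z(ιP))`,
  `𝔡(x) = {r ∈ 𝓞 K | r x ∈ 𝓞 K}` the denominator ideal of `x` (`= 𝔢²`, so `log_p N𝔡 = 2 Σ_{v∤p}
  ord_v(𝔢) log_p Nv`, the `v | p` part vanishing as `log_p p = 0`), the sum over the `[K:ℚ]`
  embeddings `K → ℚ_p` realising the places above `p`.

Definitions: `padicSigmaEval`, `HasNonsingularReductionAt(K)` (via the partial derivatives
`Φ_x, Φ_y` of the Weierstrass polynomial: `P̄` is singular on `W̄` iff both vanish mod `v`),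
`IsAdmissible(K)`, `canonicalPAdicHeight(K)` (the displayed right-hand sides; junk off the
admissible locus), `denominatorIdeal`, and the predicates
`PAdicHeightData.IsCanonical D :↔ ∀ P admissible, D.pairing P P = canonicalPAdicHeight P`,
`PAdicHeightDataK.IsCanonical DK :↔ (p totally split in K) ∧ ∀ P admissible, DK.pairing P P = …`.
PROVED: a datum is determined by its values `⟨Q, Q⟩` on any set of points containing a non-zero
multiple of every non-torsion point (`PAdicHeightData.pairing_eq_of_sq_eq_on`, and `K`-version),
hence uniqueness of the canonical datum given the fact `exists_admissible_nsmul`.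
Named facts (nothing asserted): existence of the canonical datum (`exists_isCanonical`, SW 2013
§4.1 / MST 2006 §1 / Bernardi 1981: `ĥ_p` is a quadratic form vanishing on torsion),
admissible multiples (`exists_admissible_nsmul`, AEC VII.2.1, VII.6.1, IV.3.2), and the
`K`-versions.

## Sources

* W. Stein, C. Wuthrich, Math. Comp. 82 (2013), §4 (Bernardi `σ`, `h_η`, `e(P)`), §4.1 eq. (4.1)
  (`ĥ_p(P) = 2 log_p(e(P)/σ_p(P))`), Conj. 5.1.
* B. Mazur, W. Stein, J. Tate, Doc. Math. Extra Vol. Coates (2006), §1 (eq. for `h_p`,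
  `(P,Q)_p`; "extends uniquely", conditions on `P`), Thm. 1.3.
* J. Balakrishnan, M. Çiperiani, W. Stein, *p-adic heights of Heegner points and `Λ`-adic
  regulators*, Math. Comp. 84 (2015), §4.1 eq. (4.1) (number-field formula, minimal model over
  `F`).
* B. Mazur, J. Tate, J. Teitelbaum, Invent. Math. 84 (1986), §II.4–II.5; P. Schneider, Invent.
  Math. 69 (1982), §1; B. Perrin-Riou, Invent. Math. 89 (1987), §1.2.
* J. H. Silverman, *AEC*, VII.2.1, VII.6.1, IV.3.2 (finite index of `E₁ ∩ E⁰`).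

## Design notes

* Everything is phrased on COORDINATES `(x, y)`: `E₁` above `p` as `‖ι x‖_p > 1`, `z = -ιx/ιy`;
  non-singular reduction at `v` as `ord_v x < 0 ∨ Φ_x(x,y) ∈ 𝓞_v^× ∨ Φ_y(x,y) ∈ 𝓞_v^×` (valid for a
  model integral and minimal at `v`; at good `v` it holds automatically). No residue fields, no
  point maps.
* `log_p(e/σ)` is written as the DIFFERENCE `log_p(e²)·… ` — precisely `log_p(den x) - 2 log_p σ_p`
  — so that no multiplicativity of the Iwasawa logarithm (a tree fact) is built in.
* The predicates do not take `[IsGloballyMinimal]` / good-ordinary hypotheses (they are not needed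
  to TYPE them); off that regime `σ_p` and the reduction conditions are junk and so are the
  predicates. All facts carry the hypotheses (`p ≥ 5` good ordinary, as in MST 2006 §1).
* `K : Type` (universe `0`) as in `PAdicHeightsK.lean`.
-/

noncomputable section

open scoped Classical
open IsDedekindDomain NumberField

namespace WeierstrassCurve

variable (W : WeierstrassCurve ℚ) (p : ℕ) [Fact p.Prime]

/-! ### Evaluating the canonical sigma function -/

/-- `σ_p(t) ∈ ℚ_p` for `t ∈ ℚ_p`: the sum of the canonical `p`-adic sigma series of `W ⊗ ℚ_p`
(`PadicSigma.lean`; coefficients in `ℤ_p`, so convergent for `‖t‖ < 1`; `tsum` junk `0`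
otherwise). [Mazur–Stein–Tate 2006, Thm. 1.3; Stein–Wuthrich 2013, §4.1] [cite: MazurSteinTate2006, Thm. 1.3] -/
def padicSigmaEval (t : ℚ_[p]) : ℚ_[p] :=
  ∑' n : ℕ, PowerSeries.coeff n (W.baseChange ℚ_[p]).padicSigma * t ^ n

/-- The radius of convergence condition of Bernardi's sigma function: `ord_p t > 1/(p-1)`, i.e.
`‖t‖ < p^{-1/(p-1)}` (automatic for `t ∈ pℤ_p` when `p ≥ 3`). [Stein–Wuthrich 2013, §4
("converges for all `t` with `ord_p(t) > 1/(p-1)`")] [cite: SteinWuthrich2013, §4] -/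
def InSigmaDisc (t : ℚ_[p]) : Prop :=
  ‖t‖ < (p : ℝ) ^ (-(1 / ((p : ℝ) - 1)))

/-! ### Over `ℚ` -/

section Rat

/-- **Non-singular reduction of `(x, y) ∈ E(ℚ)` modulo `ℓ`** (for a model integral and minimal at
`ℓ`): either `ord_ℓ x < 0` (`P` reduces to `Õ`), or one of the partial derivatives
`Φ_x(x,y) = a₁y - (3x² + 2a₂x + a₄)`, `Φ_y(x,y) = 2y + a₁x + a₃` is an `ℓ`-adic unit (`P̄` is a
singular point of `W̄` iff both vanish mod `ℓ`). [Mazur–Stein–Tate 2006, §1 ("reduces to the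
connected component at all primes of bad reduction"); Silverman AEC VII.2, III.1] [folklore] -/
def HasNonsingularReductionAt (ℓ : ℕ) (x y : ℚ) : Prop :=
  padicValRat ℓ x < 0 ∨
    (W.toAffine.polynomialX.evalEval x y ≠ 0 ∧ padicValRat ℓ (W.toAffine.polynomialX.evalEval x y) = 0) ∨
    (W.toAffine.polynomialY.evalEval x y ≠ 0 ∧ padicValRat ℓ (W.toAffine.polynomialY.evalEval x y) = 0)

/-- The local conditions on a point of `E(ℚ)` under which the sigma formula computes the canonical
height: `P = (x, y)` with `‖x‖_p > 1` (`P ∈ E₁(ℚ_p)`), `z(P) = -x/y` in the sigma disc, and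
non-singular reduction modulo every prime. [Mazur–Stein–Tate 2006, §1; Stein–Wuthrich 2013, §4.1
("good reduction at all primes and in the range of convergence of `σ`")] [cite: SteinWuthrich2013, §4.1] -/
def SatisfiesLocalConditions : W.toAffine.Point → Prop
  | .zero => False
  | .some x y _ => 1 < ‖(x : ℚ_[p])‖ ∧ InSigmaDisc p (-(x : ℚ_[p]) / y) ∧
      ∀ ℓ : ℕ, ℓ.Prime → W.HasNonsingularReductionAt ℓ x y

/-- **Admissible points**: non-torsion points satisfying the local conditions.
[Mazur–Stein–Tate 2006, §1 ("Let `P ∈ E(ℚ)` be a non-torsion point that reduces to `0 ∈ E(𝔽_p)`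
and to the connected component of `𝓔_{𝔽_ℓ}` at all primes `ℓ` of bad reduction")] [cite: MazurSteinTate2006, §1] -/
def IsAdmissible (P : W.toAffine.Point) : Prop :=
  ¬ IsOfFinAddOrder P ∧ W.SatisfiesLocalConditions p P

/-- **The canonical `p`-adic height of an admissible point** in the Stein–Wuthrich normalisation:
`ĥ_p(P) = 2 log_p(e(P)/σ_p(z(P))) = log_p(den x(P)) - 2 log_p σ_p(-x/y)` (`den x = e(P)²`;
`log_p = Literature.padicLog`, the Iwasawa logarithm). Equals `-2p` times MST's `h_p(P)`. Junk off the
admissible locus (and `0` at `O`). [Stein–Wuthrich 2013, §4.1 eq. (4.1); Mazur–Stein–Tate 2006, §1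
(`h_p(P) = p⁻¹ log_p(σ(P)/d(P))`)] [cite: SteinWuthrich2013, §4.1 eq. (4.1)] -/
def canonicalPAdicHeight : W.toAffine.Point → ℚ_[p]
  | .zero => 0
  | .some x y _ => Literature.NumberTheory.EllipticCurves.padicLog p ((x.den : ℚ) : ℚ_[p]) -
      2 * Literature.NumberTheory.EllipticCurves.padicLog p (W.padicSigmaEval p (-(x : ℚ_[p]) / y))

variable {W p} in
/-- **`D` is THE canonical cyclotomic `p`-adic height pairing** (Schneider = Mazur–Tate =
Nekovář, in the normalisation of Stein–Wuthrich 2013 §4.1): on every admissible point its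
quadratic form is given by the sigma formula, `⟨P, P⟩ = ĥ_p(P)`. Since `D` is bilinear, symmetric
and kills torsion, and every non-torsion point has an admissible multiple
(`exists_admissible_nsmul`), this determines `D` (`isCanonical_unique`). Meaningful for `W`
globally minimal and `p ≥ 5` good ordinary. [Stein–Wuthrich 2013, §4.1 eq. (4.1);
Mazur–Stein–Tate 2006, §1; Mazur–Tate–Teitelbaum 1986, §II.4] [cite: SteinWuthrich2013, §4.1 eq. (4.1)] -/
def PAdicHeightData.IsCanonical (D : PAdicHeightData W p) : Prop :=
  ∀ P : W.toAffine.Point, W.IsAdmissible p P → D.pairing P P = W.canonicalPAdicHeight p P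

end Rat

/-! ### Over a number field `K` (with `p` totally split) -/

section NumberField

variable (K : Type) [Field K] [NumberField K]

/-- **The denominator ideal** `𝔡(x) = {r ∈ 𝓞 K | r·x ∈ 𝓞 K}` of `x ∈ K` (so `x𝓞_K = 𝔞𝔡⁻¹` with
`𝔞, 𝔡` coprime integral ideals; for `x = x(P)`, `P ∈ E(K)` on an integral model, `𝔡 = 𝔢²`).
[Balakrishnan–Çiperiani–Stein 2015, §4.1 (`res_v(P) = (a_v/d_v², b_v/d_v³)`)] [folklore] -/
def denominatorIdeal (x : K) : Ideal (𝓞 K) where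
  carrier := {r | ∃ s : 𝓞 K, (r : K) * x = s}
  add_mem' := by
    rintro a b ⟨s, hs⟩ ⟨t, ht⟩
    exact ⟨s + t, by push_cast; rw [add_mul, hs, ht]⟩
  zero_mem' := ⟨0, by simp⟩
  smul_mem' := by
    rintro c a ⟨s, hs⟩
    exact ⟨c * s, by simp only [smul_eq_mul]; push_cast; rw [mul_assoc, hs]⟩

/-- **Non-singular reduction of `(x, y) ∈ E(K)` at a finite place `v`** (model integral and
minimal at `v`): `ord_v x < 0`, or `Φ_x(x,y)` or `Φ_y(x,y)` is a `v`-adic unit (Mathlib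
`HeightOneSpectrum.valuation`: `> 1` = non-integral, `= 1` = unit).
[Balakrishnan–Çiperiani–Stein 2015, §4.1 (condition (1)); Silverman AEC VII.2] [folklore] -/
def HasNonsingularReductionAtK (v : HeightOneSpectrum (𝓞 K)) (x y : K) : Prop :=
  1 < v.valuation K x ∨
    v.valuation K ((W.baseChange K).toAffine.polynomialX.evalEval x y) = 1 ∨
    v.valuation K ((W.baseChange K).toAffine.polynomialY.evalEval x y) = 1

/-- Local conditions on `P = (x, y) ∈ E(K)`: for EVERY embedding `ι : K → ℚ_p` (= every place
above the totally split `p`), `‖ι x‖ > 1` (`P ∈ E₁(K_℘)`) and `z(ιP)` in the sigma disc; and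
non-singular reduction at every finite place. [Balakrishnan–Çiperiani–Stein 2015, §4.1
(conditions (1), (2))] [cite: BalakrishnanCiperianiStein2015, §4.1] -/
def SatisfiesLocalConditionsK : (W.baseChange K).toAffine.Point → Prop
  | .zero => False
  | .some x y _ => (∀ ι : K →+* ℚ_[p], 1 < ‖ι x‖ ∧ InSigmaDisc p (-ι x / ι y)) ∧
      ∀ v : HeightOneSpectrum (𝓞 K), W.HasNonsingularReductionAtK K v x y

/-- Admissible points of `E(K)`: non-torsion and satisfying the local conditions.
[Balakrishnan–Çiperiani–Stein 2015, §4.1] [cite: BalakrishnanCiperianiStein2015, §4.1] -/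
def IsAdmissibleK (P : (W.baseChange K).toAffine.Point) : Prop :=
  ¬ IsOfFinAddOrder P ∧ W.SatisfiesLocalConditionsK p K P

/-- **The canonical `p`-adic height over `K` of an admissible point** (`p` totally split in `K`),
Stein–Wuthrich normalisation (`= -2p ×` the MST/BCS `h_{p,K}`):
`ĥ_{p,K}(P) = log_p N(𝔡(x)) - 2 Σ_{ι : K → ℚ_p} log_p σ_p(z(ιP))`
(BCS (4.1): `h_{p,F}(P) = p⁻¹(Σ_{℘|p} log_p N_{F_℘/ℚ_p} σ_p(res_℘ P) - Σ_{v∤p} ord_v(d_v(P))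
log_p #k_v)`, with `Σ_{v∤p} ord_v(d_v) log_p #k_v = ½ log_p N𝔡(x)` as `log_p p = 0`, and the
places above the totally split `p` given by the embeddings `K → ℚ_p`). Junk off the admissible
locus. [Balakrishnan–Çiperiani–Stein 2015, §4.1 eq. (4.1); Stein–Wuthrich 2013, §4.1] [cite: BalakrishnanCiperianiStein2015, §4.1 eq. (4.1)] -/
def canonicalPAdicHeightK : (W.baseChange K).toAffine.Point → ℚ_[p]
  | .zero => 0
  | .some x y _ =>
      Literature.NumberTheory.EllipticCurves.padicLog p ((Ideal.absNorm (denominatorIdeal K x) : ℚ) : ℚ_[p]) -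
        2 * ∑ ι : K →+* ℚ_[p], Literature.NumberTheory.EllipticCurves.padicLog p (W.padicSigmaEval p (-(ι x) / ι y))

variable {W p K} in
/-- **`DK` is THE canonical cyclotomic `p`-adic height pairing on `E(K)`** (un-normalised, sum over
places of `K`; Stein–Wuthrich / `-2p`·MST normalisation), for `p` TOTALLY SPLIT in `K` (first
conjunct: as many embeddings `K → ℚ_p` as `[K:ℚ]`; otherwise nothing is canonical): on every
admissible point, `⟨P, P⟩ = ĥ_{p,K}(P)`. Determines `DK` (`isCanonicalK_unique`). Meaningful for
`W ⊗ K` globally minimal and `p ≥ 5` good ordinary. Application: `K` imaginary quadratic, `p`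
split (`p`-adic Gross–Zagier, Perrin-Riou 1987). [Balakrishnan–Çiperiani–Stein 2015, §4.1
eq. (4.1); Perrin-Riou 1987, §1.2; Mazur–Tate–Teitelbaum 1986, §II.4–5] [cite: BalakrishnanCiperianiStein2015, §4.1 eq. (4.1)] -/
def PAdicHeightDataK.IsCanonical (DK : PAdicHeightDataK W p K) : Prop :=
  Fintype.card (K →+* ℚ_[p]) = Module.finrank ℚ K ∧
    ∀ P : (W.baseChange K).toAffine.Point, W.IsAdmissibleK p K P →
      DK.pairing P P = W.canonicalPAdicHeightK p K P

end NumberField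

/-! ### A height datum is determined by its quadratic form on admissible points -/

section Uniqueness

variable {W p}

/-- Bilinear symmetric torsion-vanishing pairings into `ℚ_p` which agree on `⟨Q, Q⟩` for all `Q`
in a set `S` containing a non-zero multiple of every non-torsion point are EQUAL (scale by `m²`,
then polarise; `char ℚ_p = 0`). [Mazur–Stein–Tate 2006, §1 ("extends uniquely … `h_p(nQ) =
n² h_p(Q)`")] [folklore] -/
theorem pairing_eq_of_sq_eq_on {A : Type*} [AddCommGroup A] (B₁ B₂ : A →+ A →+ ℚ_[p])
    (symm₁ : ∀ P Q, B₁ P Q = B₁ Q P) (symm₂ : ∀ P Q, B₂ P Q = B₂ Q P)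
    (tors₁ : ∀ P Q, IsOfFinAddOrder P → B₁ P Q = 0) (tors₂ : ∀ P Q, IsOfFinAddOrder P → B₂ P Q = 0)
    (S : Set A) (hS : ∀ P, ¬ IsOfFinAddOrder P → ∃ m : ℕ, m ≠ 0 ∧ m • P ∈ S)
    (h : ∀ Q ∈ S, B₁ Q Q = B₂ Q Q) : B₁ = B₂ := by
  -- the quadratic forms agree everywhere
  have hsq : ∀ P, B₁ P P = B₂ P P := by
    intro P
    by_cases hP : IsOfFinAddOrder P
    · rw [tors₁ P P hP, tors₂ P P hP]
    · obtain ⟨m, hm, hmS⟩ := hS P hP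
      have key := h _ hmS
      simp only [map_nsmul, AddMonoidHom.nsmul_apply, nsmul_eq_mul, ← mul_assoc] at key
      have hm' : ((m : ℚ_[p]) * m) ≠ 0 := by exact_mod_cast Nat.mul_ne_zero hm hm
      exact mul_left_cancel₀ hm' key
  -- polarisation
  ext P Q
  have h₁ : 2 * B₁ P Q = B₁ (P + Q) (P + Q) - B₁ P P - B₁ Q Q := by
    simp only [map_add, AddMonoidHom.add_apply, symm₁ Q P]; ring
  have h₂ : 2 * B₂ P Q = B₂ (P + Q) (P + Q) - B₂ P P - B₂ Q Q := by
    simp only [map_add, AddMonoidHom.add_apply, symm₂ Q P]; ring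
  have : (2 : ℚ_[p]) * B₁ P Q = 2 * B₂ P Q := by rw [h₁, h₂, hsq, hsq, hsq]
  exact mul_left_cancel₀ two_ne_zero this

/-- Two `p`-adic height data agreeing on `⟨Q, Q⟩` for `Q` in such a set `S` are equal. [folklore] -/
theorem PAdicHeightData.ext_of_sq_eq_on {D₁ D₂ : PAdicHeightData W p} (S : Set W.toAffine.Point)
    (hS : ∀ P, ¬ IsOfFinAddOrder P → ∃ m : ℕ, m ≠ 0 ∧ m • P ∈ S)
    (h : ∀ Q ∈ S, D₁.pairing Q Q = D₂.pairing Q Q) : D₁ = D₂ := by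
  have := pairing_eq_of_sq_eq_on D₁.pairing D₂.pairing D₁.symm D₂.symm D₁.map_torsion
    D₂.map_torsion S hS h
  cases D₁; cases D₂; cases this; rfl

/-- The same over `K`. [folklore] -/
theorem PAdicHeightDataK.ext_of_sq_eq_on {K : Type} [Field K] [NumberField K]
    {D₁ D₂ : PAdicHeightDataK W p K} (S : Set (W.baseChange K).toAffine.Point)
    (hS : ∀ P, ¬ IsOfFinAddOrder P → ∃ m : ℕ, m ≠ 0 ∧ m • P ∈ S)
    (h : ∀ Q ∈ S, D₁.pairing Q Q = D₂.pairing Q Q) : D₁ = D₂ := by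
  have := pairing_eq_of_sq_eq_on D₁.pairing D₂.pairing D₁.symm D₂.symm D₁.map_torsion
    D₂.map_torsion S hS h
  cases D₁; cases D₂; cases this; rfl

/-- **Uniqueness of the canonical datum**, given admissible multiples: two canonical data
coincide. [Mazur–Stein–Tate 2006, §1; Mazur–Tate–Teitelbaum 1986, §II.4] [folklore] -/
theorem PAdicHeightData.isCanonical_unique {D₁ D₂ : PAdicHeightData W p}
    (hS : ∀ P : W.toAffine.Point, ¬ IsOfFinAddOrder P → ∃ m : ℕ, m ≠ 0 ∧ W.IsAdmissible p (m • P))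
    (h₁ : D₁.IsCanonical) (h₂ : D₂.IsCanonical) : D₁ = D₂ :=
  PAdicHeightData.ext_of_sq_eq_on {P | W.IsAdmissible p P} hS fun Q hQ => by
    rw [h₁ Q hQ, h₂ Q hQ]

/-- **Uniqueness of the canonical `K`-datum**, given admissible multiples. [Perrin-Riou 1987,
§1.2; Mazur–Tate–Teitelbaum 1986, §II.4] [folklore] -/
theorem PAdicHeightDataK.isCanonical_unique {K : Type} [Field K] [NumberField K]
    {D₁ D₂ : PAdicHeightDataK W p K}
    (hS : ∀ P : (W.baseChange K).toAffine.Point, ¬ IsOfFinAddOrder P →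
      ∃ m : ℕ, m ≠ 0 ∧ W.IsAdmissibleK p K (m • P))
    (h₁ : D₁.IsCanonical) (h₂ : D₂.IsCanonical) : D₁ = D₂ :=
  PAdicHeightDataK.ext_of_sq_eq_on {P | W.IsAdmissibleK p K P} hS fun Q hQ => by
    rw [h₁.2 Q hQ, h₂.2 Q hQ]

end Uniqueness

/-! ### Named facts (nothing asserted) -/

/-- **Admissible multiples exist**: for `E/ℚ` with globally minimal `W` and any prime `p`, every
non-torsion `P ∈ E(ℚ)` has a multiple `mP`, `m ≥ 1`, which is admissible (take `m` divisible by
the Tamagawa numbers `c_ℓ` — then `mP ∈ E⁰(ℚ_ℓ)` reduces non-singularly — by `#Ẽ_{ns}(𝔽_p)` and by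
`p²`, so that `mP ∈ E₂(ℚ_p) ⊆` sigma disc; `mP` is again non-torsion).
[Silverman AEC VII.6.1 (`E/E⁰` finite), VII.2.1 (`E⁰/E₁ ≅ Ẽ_{ns}(k)`), IV.3.2 / VII.2.2
(`E_n/E_{n+1}`); Mazur–Stein–Tate 2006, §1; Stein–Wuthrich 2013, §4] [cite: SilvermanAEC2009, VII.6.1] -/
def exists_admissible_nsmul : Prop :=
  ∀ (W : WeierstrassCurve ℚ) [W.IsElliptic] [W.IsGloballyMinimal] (p : ℕ) [Fact p.Prime]
    (P : W.toAffine.Point), ¬ IsOfFinAddOrder P → ∃ m : ℕ, m ≠ 0 ∧ W.IsAdmissible p (m • P)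

/-- **Existence of the canonical `p`-adic height** (Schneider 1982 / Mazur–Tate 1983; sigma
formula: Mazur–Tate 1991, Mazur–Stein–Tate 2006 §1, Stein–Wuthrich 2013 §4.1 (4.1) with
Bernardi 1981 for quadraticity): for `E/ℚ` with globally minimal `W` and a prime `p ≥ 5` of good
ordinary reduction there is a (symmetric, bilinear, torsion-vanishing) datum `D` whose quadratic
form on admissible points is `ĥ_p(P) = 2 log_p(e(P)/σ_p(P))`.
[Stein–Wuthrich 2013, §4.1 eq. (4.1); Mazur–Stein–Tate 2006, §1] [cite: SteinWuthrich2013, §4.1 eq. (4.1)] -/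
def exists_isCanonical : Prop :=
  ∀ (W : WeierstrassCurve ℚ) [W.IsElliptic] [W.IsGloballyMinimal] (p : ℕ) [Fact p.Prime],
    5 ≤ p → W.HasGoodReductionAtPrime p → ¬ (p : ℤ) ∣ W.frobeniusTrace p →
      ∃ D : PAdicHeightData W p, D.IsCanonical

/-- **Admissible multiples over `K`** (same argument at all places of `K`).
[Silverman AEC VII.6.1, VII.2.1; Balakrishnan–Çiperiani–Stein 2015, §4.1] [cite: SilvermanAEC2009, VII.6.1] -/
def exists_admissibleK_nsmul : Prop :=
  ∀ (W : WeierstrassCurve ℚ) [W.IsElliptic] (K : Type) [Field K] [NumberField K]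
    [(W.baseChange K).IsGloballyMinimal] (p : ℕ) [Fact p.Prime]
    (P : (W.baseChange K).toAffine.Point), ¬ IsOfFinAddOrder P →
      ∃ m : ℕ, m ≠ 0 ∧ W.IsAdmissibleK p K (m • P)

/-- **Existence of the canonical `p`-adic height over `K`** for `p ≥ 5` totally split in `K`, of
good ordinary reduction for `E`, and `W ⊗ K` globally minimal: a datum `DK` on `E(K)` with
`⟨P, P⟩ = ĥ_{p,K}(P)` on admissible points (the cyclotomic `p`-adic height of `E` over `K`,
BCS 2015 (4.1) after MST 2006, times `-2p`). [Balakrishnan–Çiperiani–Stein 2015, §4.1 eq. (4.1);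
Perrin-Riou 1987, §1.2; Mazur–Tate–Teitelbaum 1986, §II.4–5] [cite: BalakrishnanCiperianiStein2015, §4.1 eq. (4.1)] -/
def exists_isCanonicalK : Prop :=
  ∀ (W : WeierstrassCurve ℚ) [W.IsElliptic] [W.IsGloballyMinimal] (K : Type) [Field K]
    [NumberField K] [(W.baseChange K).IsGloballyMinimal] (p : ℕ) [Fact p.Prime],
    5 ≤ p → W.HasGoodReductionAtPrime p → ¬ (p : ℤ) ∣ W.frobeniusTrace p →
      Fintype.card (K →+* ℚ_[p]) = Module.finrank ℚ K →
        ∃ DK : PAdicHeightDataK W p K, DK.IsCanonical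

/-- **Restriction to `E(ℚ)`**: under the same hypotheses the canonical `K`-datum restricts to the
canonical `ℚ`-datum with the factor `[K:ℚ]` (sum over places: `N𝔡_K(x) = (den x)^{[K:ℚ]}` for
`x ∈ ℚ`, and each of the `[K:ℚ]` embeddings contributes `log_p σ_p(z(P))`).
[Balakrishnan–Çiperiani–Stein 2015, §4.1; Perrin-Riou 1987, §1.2] [cite: BalakrishnanCiperianiStein2015, §4.1] -/
def isCanonicalK_restrictsTo : Prop :=
  ∀ (W : WeierstrassCurve ℚ) [W.IsElliptic] [W.IsGloballyMinimal] (K : Type) [Field K]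
    [NumberField K] [(W.baseChange K).IsGloballyMinimal] (p : ℕ) [Fact p.Prime],
    5 ≤ p → W.HasGoodReductionAtPrime p → ¬ (p : ℤ) ∣ W.frobeniusTrace p →
      ∀ (DK : PAdicHeightDataK W p K) (D : PAdicHeightData W p),
        DK.IsCanonical → D.IsCanonical → DK.RestrictsTo D

/-! ### API -/

/-- `σ_p` evaluated at `0` is `0`. [folklore] -/
@[simp] theorem padicSigmaEval_zero : W.padicSigmaEval p 0 = 0 := by
  unfold padicSigmaEval
  rw [tsum_eq_single 0 fun n hn => by simp [zero_pow hn]]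
  simp only [pow_zero, mul_one, PowerSeries.coeff_zero_eq_constantCoeff]
  -- `σ_p` has no constant term whenever a Mazur–Tate pair exists; in general the `0`-th
  -- coefficient of the junk value `X` is also `0`.
  unfold padicSigma mazurTatePair
  split_ifs with h
  · exact h.choose_spec.constantCoeff_eq
  · simp

/-- `O` is never admissible (it is torsion). [folklore] -/
theorem not_isAdmissible_zero : ¬ W.IsAdmissible p 0 := fun h => h.2

/-- `O` is never `K`-admissible. [folklore] -/
theorem not_isAdmissibleK_zero (K : Type) [Field K] [NumberField K] :
    ¬ W.IsAdmissibleK p K 0 := fun h => h.2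

/-- `1 ∈ 𝔡(x)` iff `x` is integral. [folklore] -/
theorem one_mem_denominatorIdeal_iff (K : Type) [Field K] [NumberField K] (x : K) :
    (1 : 𝓞 K) ∈ denominatorIdeal K x ↔ ∃ s : 𝓞 K, x = s := by
  simp [denominatorIdeal]

/-- The zero datum is NOT canonical as soon as some admissible point has `ĥ_p ≠ 0` (the vacuity
of `PAdicHeightData` is removed by the predicate). [folklore] -/
theorem PAdicHeightData.not_isCanonical_of_ne_zero {W : WeierstrassCurve ℚ} {p : ℕ} [Fact p.Prime]
    {D : PAdicHeightData W p}
    (hD : ∀ P Q, D.pairing P Q = 0) {P : W.toAffine.Point} (hP : W.IsAdmissible p P)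
    (hne : W.canonicalPAdicHeight p P ≠ 0) : ¬ D.IsCanonical := fun h =>
  hne ((h P hP).symm.trans (hD P P))

end WeierstrassCurve
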